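import Literature.AlgebraicGeometry.HodgeTheory.PolarizedLimitMixedHodgeStructureHodgeNormGrowth
import HarnessLib

/-!
# Cattani–Deligne–Kaplan, Prop. 3.10 (one `𝔰𝔩₂`): the Hodge classes of `F_♯ = exp(iN)·F̂` lying in `W_k` are exactly the
# `𝔰𝔩₂`-invariant limit Hodge classes — `W_k ∩ H_♯^{p,q} = I^{p,q} ∩ ker N ∩ ker N⁺`

Topic `Literature/AlgebraicGeometry/HodgeTheory` (namespaces `…HodgeTheory.LimitMixedHodgeStructure` and
`…HodgeTheory.PolarizedLimitMixedHodgeStructure`).  Theorems only; no definition, no instance, no named fact (D-0026 net debt `0`).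

PRINTED SOURCE, VERBATIM. E. Cattani, P. Deligne, A. Kaplan, *On the locus of Hodge classes*, J. Amer. Math. Soc. 8 (1995)
483–506, p. 499: **Proposition 3.10.** «Let `A` be a real Hodge structure of weight `0` and a representation of `𝔰𝔩(2, ℝ)`. One
assumes that `ρ : 𝔰𝔩(2, ℝ) → End(A)` is a morphism of Hodge structures, with `𝔰𝔩(2, ℝ)` being given the Hodge structure of 3.4. Let
`W` be the monodromy weight filtration for `ρ(0 0; 1 0)`. Then `A_ℝ ∩ W₀ ∩ F⁰ ⊂ A^{𝔰𝔩(2,ℝ)}`.»  (Printed proof: decompose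
`A = ⊕ Symⁿ(ℝ²) ⊗ Hₙ`; a real `x ∈ W₀ ∩ F⁰` has components `(e + if)^p (e − if)^q`, in `W₀` only for `n = 0`.)  It is used in
§4 (proof of Thm. 2.16 ⟹ Thm. 2.5, Prop. 4.7): the limit `u₀ ∈ F_♯⁰`, real, of weight `≤ 0`, of a rescaled sequence of Hodge
classes is `𝔰𝔩₂`-invariant.

THE TREE'S SETTING. For a limit mixed Hodge structure `(W, F, N)` of weight `k` split over `ℝ` (`L : LimitMixedHodgeStructure V k`,
`hsplit`), the `𝔰𝔩₂`-triple `(N⁺, H, N)` (`nPlus`, `deligneH = Y − k`, `N`) acts on the pure Hodge structure `F_♯ = exp(iN)·F`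
of weight `k` (`L.sharp hsplit`, Thm. 7.5.13 (1)) through a morphism of Hodge structures (Thm. 7.5.13 (2), the tree's
`I_smul_deligneH_add_mem_endPiece_sharp`: `iH + N + N⁺ ∈ 𝔤𝔩(V)^{−1,1}_{F_♯}`, `neg_I_smul_deligneH_add_mem_endPiece_sharp`:
`−iH + N + N⁺ ∈ 𝔤𝔩(V)^{1,−1}_{F_♯}`), the weight filtration of `ρ(n₋) = N` centred at `k` is `W`, and `W_{k,ℂ} = ⊕_{m ≤ k} E_m`
(`E_m = ⊕_{p+q=m} I^{p,q}`, `H = m − k` on `E_m`).  CDK's `A` of weight `0` is `V` of weight `k` (Tate twist), `W₀ ↔ W_k`, `F⁰ ↔ F_♯^p`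
with `2p = k`.

WHAT IS PROVED (a sharpening of Prop. 3.10, Hodge piece by Hodge piece, no reality needed):
* §1 **`W_{k,ℂ} ∩ H_♯^{p,q} ⊆ E_k`** (`mem_deligneE_of_mem_baseChange_W_of_mem_sharp_piece`): if `x ∈ W_k` and `C_♯ x = c x`
  (`c ≠ 0`; `c = i^{p−q}` on `H_♯^{p,q}`) then, `C_♯` carrying `E_m` to `E_{2k−m}` (`weilOperator_sharp_apply_mem_deligneE`), the
  component of `x` in `E_m`, `m < k`, is `c⁻¹ ×` the image under `C_♯` of the component in `E_{2k−m}`, `2k − m > k`, which is `0`.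
* §2 **`E_k ∩ H_♯^{p,q} ⊆ ker N ∩ ker N⁺`** (`N_apply_eq_zero_of_mem_deligneE_of_mem_sharp_piece`, `nPlus_apply_eq_zero_…`): on `E_k`,
  `H = 0`, so `X₊ x = X₋ x = (N + N⁺) x` for `X_± = ±iH + N + N⁺`; but `X₊ x ∈ H_♯^{p−1,q+1}` and `X₋ x ∈ H_♯^{p+1,q−1}`
  (Thm. 7.5.13 (2)), two distinct Hodge pieces, so `(N + N⁺) x = 0`, and `N x ∈ E_{k−2}`, `N⁺ x ∈ E_{k+2}` vanish separately.
* §3 **`W_{k,ℂ} ∩ H_♯^{p,q} = I^{p,q} ∩ ker N ∩ ker N⁺`** (`mem_baseChange_W_and_mem_sharp_piece_iff`): an invariant vector is fixed by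
  the Cayley operator `c = exp(iN) exp((i/2)N⁺)`, and `H_♯^{p,q} = c·E_p` (`sharp_piece_eq_map`), so `x ∈ E_p ∩ E_k = I^{p,k−p}`;
  conversely `I^{p,q} ∩ ker N ∩ ker N⁺ ⊆ c·E_p ∩ W_k`.
* §4 **Prop. 3.10 as printed** (`N_apply_eq_zero_of_conj_eq_of_mem_baseChange_W_of_mem_sharp_F` and companions): a REAL
  `x ∈ W_{k,ℂ} ∩ F_♯^p` with `2p = k` lies in `H_♯^{p,p}`, hence is `𝔰𝔩₂`-invariant (`N x = N⁺ x = H x = 0`) and lies in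
  `I^{p,p}`; with `2p > k` it vanishes.
* §5 the same for the `δ`-splitting `(W, F̂, N)` of an arbitrary polarized limit mixed Hodge structure `L` (the structure whose
  `F̂_♯` carries the reference norm `|·|₀` of the norm estimates): `W_{k,ℂ} ∩ Ĥ_♯^{p,q} = Î^{p,q} ∩ ker N ∩ ker N̂⁺`.

NOT HERE: several commuting `N_j` (CDK Cor. 3.11, induction on `d`); the metric consequences (CDK §4) are the business of the
sequel files of this story.

## References

* [CattaniDeligneKaplan1995] E. Cattani, P. Deligne, A. Kaplan, *On the locus of Hodge classes*, J. Amer. Math. Soc. 8 (1995)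
  483–506: Prop. 3.10 (p. 499), 3.4 (p. 495), Prop. 4.7 (p. 503).
* [CattaniElZeinGriffithsLe2014] E. Cattani, F. El Zein, P. Griffiths, Lê D. T. (eds.), *Hodge Theory*, Math. Notes 49 (2014):
  §7.5 (7.5.13)–(7.5.14), Thm. 7.5.13 (1)–(2) (pp. 307–308).
* [CattaniKaplanSchmid1986] E. Cattani, A. Kaplan, W. Schmid, *Degeneration of Hodge structures*, Ann. of Math. 123 (1986):
  §3 (cite only).
* [Schmid1973] W. Schmid, Invent. Math. 22 (1973): Lemma (6.24) (cite only).
-/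

noncomputable section

open scoped TensorProduct

namespace Literature.AlgebraicGeometry

open Module
open Motives Motives.MixedHodgeStructure
open Motives.HodgeStructure (conj conj_conj complexConj mem_complexConj)

universe u

variable {V : Type u} [AddCommGroup V] [Module ℚ V] {n : ℤ}

/-! ## §0 Two facts about pure Hodge structures -/

namespace Motives.HodgeStructure

/-- **`F^p ∩ conj F^p = 0` above the middle**: for a pure Hodge structure of weight `n` and `2p > n`, a vector `x ∈ F^p` with
`x̄ ∈ F^p` vanishes (`F^p ⊕ conj F^{n+1−p} = V_ℂ` and `F^p ⊆ F^{n+1−p}`). [cite: CattaniElZeinGriffithsLe2014, §7.5 Thm. 7.5.13 (1)]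
[cite: CattaniDeligneKaplan1995, proof of Lemma 4.5 (i) ("this intersection can be nonzero only for w + l₁ ≥ 0")] -/
theorem eq_zero_of_mem_F_of_conj_mem_F_of_lt (H : HodgeStructure V n) {p : ℤ} (hp : n < p + p) {x : ℂ ⊗[ℚ] V}
    (hx : x ∈ H.F p) (hcx : conj x ∈ H.F p) : x = 0 := by
  have hc := H.isCompl_F_complexConj p (n + 1 - p) (by omega)
  have hle : H.F p ≤ H.F (n + 1 - p) := H.antitone_F (by omega)
  have hx' : x ∈ H.F p ⊓ complexConj (H.F (n + 1 - p)) := ⟨hx, mem_complexConj.2 (hle hcx)⟩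
  rw [hc.inf_eq_bot, Submodule.mem_bot] at hx'
  exact hx'

/-- A real vector (`x̄ = x`) of `F^p` lies in `H^{p,p}` when `2p = n`. [cite: CattaniElZeinGriffithsLe2014, §7.5 Thm. 7.5.13 (1)] -/
theorem mem_piece_of_conj_eq_of_mem_F (H : HodgeStructure V n) {p : ℤ} (hp : p + p = n) {x : ℂ ⊗[ℚ] V} (hreal : conj x = x)
    (hx : x ∈ H.F p) : x ∈ H.piece p p :=
  (H.mem_piece_iff hp).2 ⟨hx, hreal.symm ▸ hx⟩

end Motives.HodgeStructure

namespace HodgeTheory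

variable [FiniteDimensional ℚ V] {k : ℤ}

namespace LimitMixedHodgeStructure

variable (L : LimitMixedHodgeStructure V k)

/-! ## §0' Tools on the Deligne grading `V_ℂ = ⊕_m E_m` and the `𝔰𝔩₂`-triple -/

/-- The total weights `p + q` of the nonzero `I^{p,q}` lie in a finite set. [folklore] -/
private theorem exists_weights_subset :
    ∃ s : Finset ℤ, ∀ p q : ℤ, L.toMixedHodgeStructure.deligneI p q ≠ ⊥ → p + q ∈ s := by
  classical
  refine ⟨L.toMixedHodgeStructure.finite_setOf_deligneFamily_ne_bot.toFinset.image fun pq => pq.1 + pq.2,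
    fun p q h => Finset.mem_image.2 ⟨(p, q), ?_, rfl⟩⟩
  rw [Set.Finite.mem_toFinset, Set.mem_setOf_eq, deligneFamily_apply]
  exact h

/-- **`H = m − k` on `E_m`** (`H = Y − k`, `Y = p + q` on `I^{p,q}`). [cite: CattaniElZeinGriffithsLe2014, §7.5 (7.5.13) ("Y ∈ 𝔤₀ … acts on V_ℓ as ℓ")] -/
theorem deligneH_apply_of_mem_deligneE {m : ℤ} {x : ℂ ⊗[ℚ] V} (hx : x ∈ L.toMixedHodgeStructure.deligneE m) :
    L.deligneH x = ((m - k : ℤ) : ℂ) • x := by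
  have hY : L.toMixedHodgeStructure.deligneY x = (m : ℂ) • x :=
    (L.toMixedHodgeStructure.deligneY_apply_eq_smul_iff m x).2 hx
  rw [L.deligneH_apply, hY, ← sub_smul, Int.cast_sub]

/-- `H = 0` on `E_k`. [cite: CattaniElZeinGriffithsLe2014, §7.5 (7.5.13)] -/
theorem deligneH_apply_eq_zero_of_mem_deligneE {x : ℂ ⊗[ℚ] V} (hx : x ∈ L.toMixedHodgeStructure.deligneE k) :
    L.deligneH x = 0 := by
  rw [L.deligneH_apply_of_mem_deligneE hx, sub_self, Int.cast_zero, zero_smul]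

/-- **`N⁺ E_m ⊆ E_{m+2}`** (`N⁺ I^{p,q} ⊆ I^{p+1,q+1}`). [cite: CattaniElZeinGriffithsLe2014, §7.5 (7.5.13)–(7.5.14)] -/
theorem nPlus_apply_mem_deligneE {m : ℤ} {x : ℂ ⊗[ℚ] V} (hx : x ∈ L.toMixedHodgeStructure.deligneE m) :
    L.nPlus x ∈ L.toMixedHodgeStructure.deligneE (m + 2) := by
  induction hx using Submodule.iSup_induction' with
  | mem pq x hx =>
    induction hx using Submodule.iSup_induction' with
    | mem hpq x hx =>
      have hpq' : pq.1 + pq.2 = m := hpq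
      exact L.toMixedHodgeStructure.deligneI_le_deligneE (show pq.1 + 1 + (pq.2 + 1) = m + 2 by omega)
        (L.nPlus_apply_mem (show x ∈ L.toMixedHodgeStructure.deligneI pq.1 pq.2 from hx))
    | zero => simp
    | add x y _ _ hx hy => rw [map_add]; exact Submodule.add_mem _ hx hy
  | zero => simp
  | add x y _ _ hx hy => rw [map_add]; exact Submodule.add_mem _ hx hy

omit [FiniteDimensional ℚ V] in
/-- `exp(cT) x = x` when `T x = 0` (`T` nilpotent). [folklore] -/
private theorem exp_smul_apply_eq_self_of_apply_eq_zero {T : Module.End ℂ (ℂ ⊗[ℚ] V)} (hT : IsNilpotent T) (c : ℂ)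
    {x : ℂ ⊗[ℚ] V} (hx : T x = 0) : IsNilpotent.exp (c • T) x = x := by
  obtain ⟨n, hn⟩ := hT
  have hT1 : T ^ (n + 1) = 0 := by rw [pow_succ, hn, zero_mul]
  have hn' : (c • T) ^ (n + 1) = 0 := by rw [smul_pow, hT1, smul_zero]
  rw [IsNilpotent.exp_eq_sum hn', LinearMap.sum_apply, Finset.sum_range_succ', pow_zero, Nat.factorial_zero, Nat.cast_one,
    inv_one, one_smul, Module.End.one_apply, add_eq_right]
  refine Finset.sum_eq_zero fun i _ => ?_
  rw [LinearMap.smul_apply, pow_succ, Module.End.mul_apply, LinearMap.smul_apply, hx, smul_zero, map_zero, smul_zero]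

/-- **The Cayley operator fixes the `𝔰𝔩₂`-invariants**: `c x = x` for `c = exp(iN_ℂ) exp((i/2)N⁺)` when `N x = N⁺ x = 0`.
[cite: CattaniElZeinGriffithsLe2014, §7.5 Thm. 7.5.13 (1)–(2)] -/
theorem cayley_apply_of_N_apply_eq_zero_of_nPlus_apply_eq_zero {x : ℂ ⊗[ℚ] V} (hN : L.N.baseChange ℂ x = 0)
    (hP : L.nPlus x = 0) : L.cayley x = x := by
  rw [cayley, Module.End.mul_apply, exp_smul_apply_eq_self_of_apply_eq_zero L.isNilpotent_nPlus _ hP,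
    exp_smul_apply_eq_self_of_apply_eq_zero L.isNilpotent_N_baseChange _ hN]

/-- **`E_p ∩ E_m = I^{p,m−p}`**: a vector lying in the sum of the `I^{p,q'}` with first index `p` and in the sum of the `I^{a,b}`
of total weight `m` lies in `I^{p,m−p}` (independence of the bigrading). [cite: CattaniElZeinGriffithsLe2014, Prop. 3.2.19 and (7.6.2)] -/
theorem mem_deligneI_of_mem_biSup_fst_of_mem_deligneE {p m : ℤ} {x : ℂ ⊗[ℚ] V}
    (hp : x ∈ ⨆ pq ∈ {pq : ℤ × ℤ | pq.1 = p}, L.toMixedHodgeStructure.deligneFamily pq)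
    (hm : x ∈ L.toMixedHodgeStructure.deligneE m) : x ∈ L.toMixedHodgeStructure.deligneI p (m - p) := by
  classical
  rw [← L.toMixedHodgeStructure.sum_deligneProj_apply x]
  refine Submodule.sum_mem _ fun pq _ => ?_
  by_cases h : pq = (p, m - p)
  · rw [h]
    have hmem := L.toMixedHodgeStructure.deligneProj_apply_mem (p, m - p) x
    rwa [deligneFamily_apply] at hmem
  · have h0 : L.toMixedHodgeStructure.deligneProj pq x = 0 := by
      by_cases h1 : pq.1 = p
      · have h2 : pq ∉ {pq : ℤ × ℤ | pq.1 + pq.2 = m} := by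
          intro h2
          apply h
          simp only [Set.mem_setOf_eq] at h2
          exact Prod.ext h1 (by simp only; omega)
        rw [deligneE_eq_biSup_mem] at hm
        exact L.toMixedHodgeStructure.deligneProj_apply_eq_zero_of_mem_biSup h2 hm
      · exact L.toMixedHodgeStructure.deligneProj_apply_eq_zero_of_mem_biSup (S := {pq : ℤ × ℤ | pq.1 = p}) h1 hp
    rw [h0]
    exact zero_mem _

/-! ## §1 `W_k ∩ H_♯^{p,q} ⊆ E_k`: a `C_♯`-eigenvector of weight `≤ k` has pure weight `k` -/

/-- **A `C_♯`-eigenvector in `W_{k,ℂ}` lies in `E_k`**: if `x ∈ W_k ⊗ ℂ` and `C_♯ x = c x` with `c ≠ 0` then `x ∈ E_k` —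
`C_♯ E_m ⊆ E_{2k−m}` exchanges the weights below `k` with the weights above `k`, and `x` has none above.
[cite: CattaniDeligneKaplan1995, Prop. 3.10 (p. 499)] [cite: CattaniElZeinGriffithsLe2014, §7.5 Thm. 7.5.13 (2)] -/
theorem mem_deligneE_of_mem_baseChange_W_of_weilOperator_sharp_eq_smul (hsplit : L.toMixedHodgeStructure.IsSplitOverR)
    {x : ℂ ⊗[ℚ] V} (hx : x ∈ (L.W k).baseChange ℂ) {c : ℂ} (hc : c ≠ 0) (hC : (L.sharp hsplit).weilOperator x = c • x) :
    x ∈ L.toMixedHodgeStructure.deligneE k := by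
  classical
  obtain ⟨s, hs⟩ := L.exists_weights_subset
  have hzero : ∀ m ∈ s, m ≠ k → L.toMixedHodgeStructure.deligneEProj m x = 0 := by
    intro m _ hmk
    rcases lt_or_gt_of_ne hmk with hlt | hgt
    · -- `m < k`: compare the `E_m`-components of `C_♯ x = c x`
      have h1 : L.toMixedHodgeStructure.deligneEProj m ((L.sharp hsplit).weilOperator x) =
          c • L.toMixedHodgeStructure.deligneEProj m x := by rw [hC, map_smul]
      have h2 : L.toMixedHodgeStructure.deligneEProj m ((L.sharp hsplit).weilOperator x) = 0 := by
        conv_lhs => rw [← L.toMixedHodgeStructure.sum_deligneEProj_apply s hs x]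
        rw [map_sum, map_sum]
        refine Finset.sum_eq_zero fun m' _ => ?_
        have hmem := L.weilOperator_sharp_apply_mem_deligneE hsplit (L.toMixedHodgeStructure.deligneEProj_apply_mem m' x)
        by_cases h : 2 * k - m' = m
        · have hm'k : k < m' := by omega
          rw [L.toMixedHodgeStructure.deligneEProj_apply_eq_zero_of_mem_baseChange_W hm'k hx, map_zero, map_zero]
        · exact L.toMixedHodgeStructure.deligneEProj_apply_of_mem_deligneE_of_ne h hmem
      rw [h2] at h1
      exact (smul_eq_zero.1 h1.symm).resolve_left hc
    · exact L.toMixedHodgeStructure.deligneEProj_apply_eq_zero_of_mem_baseChange_W hgt hx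
  rw [← L.toMixedHodgeStructure.sum_deligneEProj_apply s hs x]
  refine Submodule.sum_mem _ fun m hm => ?_
  by_cases hmk : m = k
  · rw [hmk]
    exact L.toMixedHodgeStructure.deligneEProj_apply_mem k x
  · rw [hzero m hm hmk]
    exact zero_mem _

/-- **`W_{k,ℂ} ∩ H_♯^{p,q} ⊆ E_k`** — Step 1 of Prop. 3.10: a Hodge class of `F_♯` of weight `≤ k` has pure weight `k`
(`C_♯ = i^{p−q} ≠ 0` on `H_♯^{p,q}`). [cite: CattaniDeligneKaplan1995, Prop. 3.10 (p. 499)] [cite: CattaniElZeinGriffithsLe2014, §7.5 Thm. 7.5.13 (2)] -/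
theorem mem_deligneE_of_mem_baseChange_W_of_mem_sharp_piece (hsplit : L.toMixedHodgeStructure.IsSplitOverR) {p q : ℤ}
    {x : ℂ ⊗[ℚ] V} (hx : x ∈ (L.W k).baseChange ℂ) (hxp : x ∈ (L.sharp hsplit).piece p q) :
    x ∈ L.toMixedHodgeStructure.deligneE k := by
  by_cases hpq : p + q = k
  · have hq : q = k - p := by omega
    subst hq
    exact L.mem_deligneE_of_mem_baseChange_W_of_weilOperator_sharp_eq_smul hsplit hx (HodgeStructure.hodgeSign_ne_zero k p)
      ((L.sharp hsplit).weilOperator_apply_of_mem hxp)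
  · rw [(L.sharp hsplit).piece_eq_bot_of_add_ne hpq, Submodule.mem_bot] at hxp
    rw [hxp]
    exact zero_mem _

/-! ## §2 `E_k ∩ H_♯^{p,q} ⊆ ker N ∩ ker N⁺`: weight-`k` Hodge classes of `F_♯` are `𝔰𝔩₂`-invariant -/

/-- **`(N + N⁺) x = 0` for `x ∈ E_k ∩ H_♯^{p,q}`** — Step 2 of Prop. 3.10: `H x = 0`, so `X₊ x = X₋ x = (N + N⁺) x` with
`X_± = ±iH + N + N⁺ = ρ(±i y + n₋ + n₊)` of Hodge type `(∓1, ±1)` at `F_♯` (Thm. 7.5.13 (2)); the common value lies in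
`H_♯^{p−1,q+1} ∩ H_♯^{p+1,q−1} = 0`. [cite: CattaniDeligneKaplan1995, Prop. 3.10 (p. 499)] [cite: CattaniElZeinGriffithsLe2014, §7.5 Thm. 7.5.13 (2) (p. 308)] -/
theorem N_add_nPlus_apply_eq_zero_of_mem_deligneE_of_mem_sharp_piece (hsplit : L.toMixedHodgeStructure.IsSplitOverR)
    {p q : ℤ} {x : ℂ ⊗[ℚ] V} (hE : x ∈ L.toMixedHodgeStructure.deligneE k) (hxp : x ∈ (L.sharp hsplit).piece p q) :
    L.N.baseChange ℂ x + L.nPlus x = 0 := by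
  by_cases hpq : p + q = k
  swap
  · rw [(L.sharp hsplit).piece_eq_bot_of_add_ne hpq, Submodule.mem_bot] at hxp
    rw [hxp, map_zero, map_zero, add_zero]
  have hH : L.deligneH x = 0 := L.deligneH_apply_eq_zero_of_mem_deligneE hE
  have hxI : x ∈ (L.sharp hsplit).toMixedHodgeStructure.deligneI p q := by
    rw [HodgeStructure.toMixedHodgeStructure_deligneI]
    exact hxp
  have hplus := MixedHodgeStructure.apply_mem_of_mem_endPiece (L.I_smul_deligneH_add_mem_endPiece_sharp hsplit) hxI
  have hminus := MixedHodgeStructure.apply_mem_of_mem_endPiece (L.neg_I_smul_deligneH_add_mem_endPiece_sharp hsplit) hxI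
  rw [HodgeStructure.toMixedHodgeStructure_deligneI] at hplus hminus
  simp only [LinearMap.add_apply, LinearMap.smul_apply, hH, smul_zero, zero_add] at hplus hminus
  -- the common value `y = N x + N⁺ x` lies in two distinct Hodge pieces of `F_♯`
  have hy1 : (L.sharp hsplit).pieceProj (p - 1) (L.N.baseChange ℂ x + L.nPlus x) = L.N.baseChange ℂ x + L.nPlus x :=
    (L.sharp hsplit).pieceProj_apply_of_mem (by
      rw [show k - (p - 1) = q + 1 by omega, show p - 1 = p + -1 by ring]
      exact hplus)
  have hy0 : (L.sharp hsplit).pieceProj (p - 1) (L.N.baseChange ℂ x + L.nPlus x) = 0 :=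
    (L.sharp hsplit).pieceProj_apply_of_mem_ne (show p + 1 ≠ p - 1 by omega) (by
      rw [show k - (p + 1) = q + -1 by omega]
      exact hminus)
  rw [← hy1, hy0]

/-- **`N x = 0` for `x ∈ E_k ∩ H_♯^{p,q}`** (`N x ∈ E_{k−2}` is the `E_{k−2}`-component of `(N + N⁺) x = 0`).
[cite: CattaniDeligneKaplan1995, Prop. 3.10 (p. 499)] [cite: CattaniElZeinGriffithsLe2014, §7.5 Thm. 7.5.13 (2)] -/
theorem N_apply_eq_zero_of_mem_deligneE_of_mem_sharp_piece (hsplit : L.toMixedHodgeStructure.IsSplitOverR) {p q : ℤ}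
    {x : ℂ ⊗[ℚ] V} (hE : x ∈ L.toMixedHodgeStructure.deligneE k) (hxp : x ∈ (L.sharp hsplit).piece p q) :
    L.N.baseChange ℂ x = 0 := by
  have hy := L.N_add_nPlus_apply_eq_zero_of_mem_deligneE_of_mem_sharp_piece hsplit hE hxp
  have hN : L.N.baseChange ℂ x ∈ L.toMixedHodgeStructure.deligneE (k - 2) := L.N_baseChange_apply_mem_deligneE hE
  have hP : L.nPlus x ∈ L.toMixedHodgeStructure.deligneE (k + 2) := L.nPlus_apply_mem_deligneE hE
  have h := congr_arg (L.toMixedHodgeStructure.deligneEProj (k - 2)) hy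
  rwa [map_zero, map_add, L.toMixedHodgeStructure.deligneEProj_apply_of_mem_deligneE hN,
    L.toMixedHodgeStructure.deligneEProj_apply_of_mem_deligneE_of_ne (show k + 2 ≠ k - 2 by omega) hP, add_zero] at h

/-- **`N⁺ x = 0` for `x ∈ E_k ∩ H_♯^{p,q}`.** [cite: CattaniDeligneKaplan1995, Prop. 3.10 (p. 499)] [cite: CattaniElZeinGriffithsLe2014, §7.5 Thm. 7.5.13 (2)] -/
theorem nPlus_apply_eq_zero_of_mem_deligneE_of_mem_sharp_piece (hsplit : L.toMixedHodgeStructure.IsSplitOverR) {p q : ℤ}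
    {x : ℂ ⊗[ℚ] V} (hE : x ∈ L.toMixedHodgeStructure.deligneE k) (hxp : x ∈ (L.sharp hsplit).piece p q) :
    L.nPlus x = 0 := by
  have hy := L.N_add_nPlus_apply_eq_zero_of_mem_deligneE_of_mem_sharp_piece hsplit hE hxp
  rwa [L.N_apply_eq_zero_of_mem_deligneE_of_mem_sharp_piece hsplit hE hxp, zero_add] at hy

/-- **`W_{k,ℂ} ∩ H_♯^{p,q} ⊆ ker N`**: a Hodge class of `F_♯` of weight `≤ k` is killed by the monodromy logarithm.
[cite: CattaniDeligneKaplan1995, Prop. 3.10 (p. 499)] [cite: CattaniElZeinGriffithsLe2014, §7.5 Thm. 7.5.13 (2)] -/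
theorem N_apply_eq_zero_of_mem_baseChange_W_of_mem_sharp_piece (hsplit : L.toMixedHodgeStructure.IsSplitOverR) {p q : ℤ}
    {x : ℂ ⊗[ℚ] V} (hx : x ∈ (L.W k).baseChange ℂ) (hxp : x ∈ (L.sharp hsplit).piece p q) : L.N.baseChange ℂ x = 0 :=
  L.N_apply_eq_zero_of_mem_deligneE_of_mem_sharp_piece hsplit (L.mem_deligneE_of_mem_baseChange_W_of_mem_sharp_piece hsplit hx hxp)
    hxp

/-- **`W_{k,ℂ} ∩ H_♯^{p,q} ⊆ ker N⁺`.** [cite: CattaniDeligneKaplan1995, Prop. 3.10 (p. 499)] [cite: CattaniElZeinGriffithsLe2014, §7.5 Thm. 7.5.13 (2)] -/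
theorem nPlus_apply_eq_zero_of_mem_baseChange_W_of_mem_sharp_piece (hsplit : L.toMixedHodgeStructure.IsSplitOverR) {p q : ℤ}
    {x : ℂ ⊗[ℚ] V} (hx : x ∈ (L.W k).baseChange ℂ) (hxp : x ∈ (L.sharp hsplit).piece p q) : L.nPlus x = 0 :=
  L.nPlus_apply_eq_zero_of_mem_deligneE_of_mem_sharp_piece hsplit
    (L.mem_deligneE_of_mem_baseChange_W_of_mem_sharp_piece hsplit hx hxp) hxp

/-- **`W_{k,ℂ} ∩ H_♯^{p,q} ⊆ ker H`.** [cite: CattaniDeligneKaplan1995, Prop. 3.10 (p. 499)] -/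
theorem deligneH_apply_eq_zero_of_mem_baseChange_W_of_mem_sharp_piece (hsplit : L.toMixedHodgeStructure.IsSplitOverR) {p q : ℤ}
    {x : ℂ ⊗[ℚ] V} (hx : x ∈ (L.W k).baseChange ℂ) (hxp : x ∈ (L.sharp hsplit).piece p q) : L.deligneH x = 0 :=
  L.deligneH_apply_eq_zero_of_mem_deligneE (L.mem_deligneE_of_mem_baseChange_W_of_mem_sharp_piece hsplit hx hxp)

/-! ## §3 `W_k ∩ H_♯^{p,q} = I^{p,q} ∩ ker N ∩ ker N⁺` -/

/-- **`W_{k,ℂ} ∩ H_♯^{p,q} ⊆ I^{p,q}`**: an `𝔰𝔩₂`-invariant `x` is fixed by the Cayley operator, and `H_♯^{p,q} = c·E_p`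
(`E_p = ⊕_{q'} I^{p,q'}`), so `x ∈ E_p ∩ E_k = I^{p,k−p}`. [cite: CattaniDeligneKaplan1995, Prop. 3.10 (p. 499)]
[cite: CattaniElZeinGriffithsLe2014, §7.5 Thm. 7.5.13 (1)–(2)] -/
theorem mem_deligneI_of_mem_baseChange_W_of_mem_sharp_piece (hsplit : L.toMixedHodgeStructure.IsSplitOverR) {p q : ℤ}
    {x : ℂ ⊗[ℚ] V} (hx : x ∈ (L.W k).baseChange ℂ) (hxp : x ∈ (L.sharp hsplit).piece p q) :
    x ∈ L.toMixedHodgeStructure.deligneI p q := by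
  by_cases hpq : p + q = k
  swap
  · rw [(L.sharp hsplit).piece_eq_bot_of_add_ne hpq, Submodule.mem_bot] at hxp
    rw [hxp]
    exact zero_mem _
  have hE := L.mem_deligneE_of_mem_baseChange_W_of_mem_sharp_piece hsplit hx hxp
  have hcx : L.cayley x = x := L.cayley_apply_of_N_apply_eq_zero_of_nPlus_apply_eq_zero
    (L.N_apply_eq_zero_of_mem_deligneE_of_mem_sharp_piece hsplit hE hxp)
    (L.nPlus_apply_eq_zero_of_mem_deligneE_of_mem_sharp_piece hsplit hE hxp)
  rw [L.sharp_piece_eq_map hsplit hpq] at hxp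
  obtain ⟨x', hx', hcx'⟩ := hxp
  have hxx' : x' = x := L.cayley_injective (hcx'.trans hcx.symm)
  rw [hxx'] at hx'
  have h := L.mem_deligneI_of_mem_biSup_fst_of_mem_deligneE hx' hE
  rwa [show k - p = q by omega] at h

/-- **`I^{p,q} ∩ ker N ∩ ker N⁺ ⊆ H_♯^{p,q}`** (`p + q = k`): `x = c x ∈ c·E_p = H_♯^{p,k−p}`.
[cite: CattaniDeligneKaplan1995, Prop. 3.10 (p. 499)] [cite: CattaniElZeinGriffithsLe2014, §7.5 Thm. 7.5.13 (1)–(2)] -/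
theorem mem_sharp_piece_of_mem_deligneI_of_N_apply_eq_zero (hsplit : L.toMixedHodgeStructure.IsSplitOverR) {p q : ℤ}
    (hpq : p + q = k) {x : ℂ ⊗[ℚ] V} (hx : x ∈ L.toMixedHodgeStructure.deligneI p q) (hN : L.N.baseChange ℂ x = 0)
    (hP : L.nPlus x = 0) : x ∈ (L.sharp hsplit).piece p q := by
  rw [L.sharp_piece_eq_map hsplit hpq]
  refine ⟨x, ?_, L.cayley_apply_of_N_apply_eq_zero_of_nPlus_apply_eq_zero hN hP⟩
  refine Submodule.mem_iSup_of_mem (p, q) (Submodule.mem_iSup_of_mem (show (p, q) ∈ {pq : ℤ × ℤ | pq.1 = p} from rfl) ?_)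
  rw [deligneFamily_apply]
  exact hx

omit [FiniteDimensional ℚ V] in
/-- `I^{p,q} ⊆ W_{k,ℂ}` for `p + q = k` (`I^{p,q} ⊆ E_k ⊆ W_k`). [cite: CattaniElZeinGriffithsLe2014, Prop. 3.2.19] -/
theorem mem_baseChange_W_of_mem_deligneI {p q : ℤ} (hpq : p + q = k) {x : ℂ ⊗[ℚ] V}
    (hx : x ∈ L.toMixedHodgeStructure.deligneI p q) : x ∈ (L.W k).baseChange ℂ :=
  L.toMixedHodgeStructure.deligneE_le_baseChange_W k (L.toMixedHodgeStructure.deligneI_le_deligneE hpq hx)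

/-- **Prop. 3.10, bigraded form: `W_{k,ℂ} ∩ H_♯^{p,q} = I^{p,q} ∩ ker N ∩ ker N⁺`** (`p + q = k`) — the Hodge classes of
`F_♯ = exp(iN)·F` of weight `≤ k` are exactly the `𝔰𝔩₂`-invariant classes of the limit bigrading, of the same type.
[cite: CattaniDeligneKaplan1995, Prop. 3.10 (p. 499)] [cite: CattaniElZeinGriffithsLe2014, §7.5 Thm. 7.5.13 (1)–(2) (p. 308)] -/
theorem mem_baseChange_W_and_mem_sharp_piece_iff (hsplit : L.toMixedHodgeStructure.IsSplitOverR) {p q : ℤ} (hpq : p + q = k)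
    (x : ℂ ⊗[ℚ] V) :
    x ∈ (L.W k).baseChange ℂ ∧ x ∈ (L.sharp hsplit).piece p q ↔
      x ∈ L.toMixedHodgeStructure.deligneI p q ∧ L.N.baseChange ℂ x = 0 ∧ L.nPlus x = 0 :=
  ⟨fun h => ⟨L.mem_deligneI_of_mem_baseChange_W_of_mem_sharp_piece hsplit h.1 h.2,
    L.N_apply_eq_zero_of_mem_baseChange_W_of_mem_sharp_piece hsplit h.1 h.2,
    L.nPlus_apply_eq_zero_of_mem_baseChange_W_of_mem_sharp_piece hsplit h.1 h.2⟩,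
    fun h => ⟨L.mem_baseChange_W_of_mem_deligneI hpq h.1, L.mem_sharp_piece_of_mem_deligneI_of_N_apply_eq_zero hsplit hpq h.1 h.2.1 h.2.2⟩⟩

/-! ## §4 Prop. 3.10 as printed: real vectors of `W_k ∩ F_♯^p` -/

/-- **CDK Prop. 3.10, verbatim form («`A_ℝ ∩ W₀ ∩ F⁰ ⊂ A^{𝔰𝔩(2,ℝ)}`»): a REAL vector `x ∈ W_{k,ℂ} ∩ F_♯^p` with `2p = k` is
`𝔰𝔩₂`-invariant — `N x = 0`, `N⁺ x = 0`, `H x = 0` — and lies in `I^{p,p}`.** (Weight `0`, `p = 0` in the source; `x` real and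
in `F_♯^p` lies in `H_♯^{p,p}`.) [cite: CattaniDeligneKaplan1995, Prop. 3.10 (p. 499)] [cite: CattaniElZeinGriffithsLe2014, §7.5 Thm. 7.5.13 (2)] -/
theorem sl2_invariant_of_conj_eq_of_mem_baseChange_W_of_mem_sharp_F (hsplit : L.toMixedHodgeStructure.IsSplitOverR) {p : ℤ}
    (hp : p + p = k) {x : ℂ ⊗[ℚ] V} (hreal : conj x = x) (hx : x ∈ (L.W k).baseChange ℂ) (hF : x ∈ (L.sharp hsplit).F p) :
    L.N.baseChange ℂ x = 0 ∧ L.nPlus x = 0 ∧ L.deligneH x = 0 ∧ x ∈ L.toMixedHodgeStructure.deligneI p p := by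
  have hxp : x ∈ (L.sharp hsplit).piece p p := (L.sharp hsplit).mem_piece_of_conj_eq_of_mem_F hp hreal hF
  exact ⟨L.N_apply_eq_zero_of_mem_baseChange_W_of_mem_sharp_piece hsplit hx hxp,
    L.nPlus_apply_eq_zero_of_mem_baseChange_W_of_mem_sharp_piece hsplit hx hxp,
    L.deligneH_apply_eq_zero_of_mem_baseChange_W_of_mem_sharp_piece hsplit hx hxp,
    L.mem_deligneI_of_mem_baseChange_W_of_mem_sharp_piece hsplit hx hxp⟩

/-- Above the middle degree there is nothing: a REAL vector of `F_♯^p` with `2p > k` vanishes (no weight hypothesis).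
[cite: CattaniDeligneKaplan1995, proof of Lemma 4.5 (i)] [cite: CattaniElZeinGriffithsLe2014, §7.5 Thm. 7.5.13 (1)] -/
theorem eq_zero_of_conj_eq_of_mem_sharp_F_of_lt (hsplit : L.toMixedHodgeStructure.IsSplitOverR) {p : ℤ} (hp : k < p + p)
    {x : ℂ ⊗[ℚ] V} (hreal : conj x = x) (hF : x ∈ (L.sharp hsplit).F p) : x = 0 :=
  (L.sharp hsplit).eq_zero_of_mem_F_of_conj_mem_F_of_lt hp hF (hreal.symm ▸ hF)

end LimitMixedHodgeStructure

/-! ## §5 For the `δ`-splitting of a polarized limit mixed Hodge structure (the `F̂_♯` of the norm estimates) -/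

namespace PolarizedLimitMixedHodgeStructure

variable (L : PolarizedLimitMixedHodgeStructure V k)

/-- **`W_{k,ℂ} ∩ Ĥ_♯^{p,q} ⊆ ker N`** for the pure Hodge structure `F̂_♯ = exp(iN)·F̂` of the `δ`-splitting `(W, F̂, N)` of `L`
(the structure `L.deltaSplit`, split over `ℝ`, same `W` and `N`). [cite: CattaniDeligneKaplan1995, Prop. 3.10 (p. 499) and Prop. 4.7 (p. 503)] -/
theorem N_apply_eq_zero_of_mem_baseChange_W_of_mem_deltaSplit_sharp_piece {p q : ℤ} {x : ℂ ⊗[ℚ] V}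
    (hx : x ∈ (L.W k).baseChange ℂ)
    (hxp : x ∈ (L.deltaSplit.toLimitMixedHodgeStructure.sharp L.isSplitOverR_deltaSplit).piece p q) :
    L.N.baseChange ℂ x = 0 :=
  L.deltaSplit.toLimitMixedHodgeStructure.N_apply_eq_zero_of_mem_baseChange_W_of_mem_sharp_piece L.isSplitOverR_deltaSplit hx hxp

/-- **`W_{k,ℂ} ∩ Ĥ_♯^{p,q} ⊆ ker N̂⁺`** (`N̂⁺` the raising operator of the `δ`-splitting). [cite: CattaniDeligneKaplan1995, Prop. 3.10 (p. 499)] -/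
theorem nPlus_deltaSplit_apply_eq_zero_of_mem_baseChange_W_of_mem_sharp_piece {p q : ℤ} {x : ℂ ⊗[ℚ] V}
    (hx : x ∈ (L.W k).baseChange ℂ)
    (hxp : x ∈ (L.deltaSplit.toLimitMixedHodgeStructure.sharp L.isSplitOverR_deltaSplit).piece p q) :
    L.deltaSplit.toLimitMixedHodgeStructure.nPlus x = 0 :=
  L.deltaSplit.toLimitMixedHodgeStructure.nPlus_apply_eq_zero_of_mem_baseChange_W_of_mem_sharp_piece L.isSplitOverR_deltaSplit
    hx hxp

/-- **`W_{k,ℂ} ∩ Ĥ_♯^{p,q} ⊆ Ê_k`**: such a vector is its own top component, `π̂_k x = x`. [cite: CattaniDeligneKaplan1995, Prop. 3.10 (p. 499) and Prop. 4.7 (p. 503)] -/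
theorem deligneEProj_apply_eq_self_of_mem_baseChange_W_of_mem_sharp_piece {p q : ℤ} {x : ℂ ⊗[ℚ] V}
    (hx : x ∈ (L.W k).baseChange ℂ)
    (hxp : x ∈ (L.deltaSplit.toLimitMixedHodgeStructure.sharp L.isSplitOverR_deltaSplit).piece p q) :
    L.deltaSplit.toMixedHodgeStructure.deligneEProj k x = x :=
  L.deltaSplit.toMixedHodgeStructure.deligneEProj_apply_of_mem_deligneE
    (L.deltaSplit.toLimitMixedHodgeStructure.mem_deligneE_of_mem_baseChange_W_of_mem_sharp_piece L.isSplitOverR_deltaSplit hx hxp)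

/-- **`W_{k,ℂ} ∩ Ĥ_♯^{p,q} = Î^{p,q} ∩ ker N ∩ ker N̂⁺`** for the `δ`-splitting of `L` (`p + q = k`).
[cite: CattaniDeligneKaplan1995, Prop. 3.10 (p. 499)] [cite: CattaniElZeinGriffithsLe2014, §7.5 Thm. 7.5.13 (1)–(2)] -/
theorem mem_baseChange_W_and_mem_deltaSplit_sharp_piece_iff {p q : ℤ} (hpq : p + q = k) (x : ℂ ⊗[ℚ] V) :
    x ∈ (L.W k).baseChange ℂ ∧ x ∈ (L.deltaSplit.toLimitMixedHodgeStructure.sharp L.isSplitOverR_deltaSplit).piece p q ↔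
      x ∈ L.deltaSplit.toMixedHodgeStructure.deligneI p q ∧ L.N.baseChange ℂ x = 0 ∧
        L.deltaSplit.toLimitMixedHodgeStructure.nPlus x = 0 :=
  L.deltaSplit.toLimitMixedHodgeStructure.mem_baseChange_W_and_mem_sharp_piece_iff L.isSplitOverR_deltaSplit hpq x

/-- **Prop. 3.10 for the `δ`-splitting, printed form**: a REAL `x ∈ W_{k,ℂ} ∩ F̂_♯^p`, `2p = k`, satisfies `N x = 0`, `N̂⁺ x = 0`,
`Ĥ x = 0` and lies in `Î^{p,p}`. [cite: CattaniDeligneKaplan1995, Prop. 3.10 (p. 499) and Prop. 4.7 (p. 503)] -/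
theorem sl2_invariant_of_conj_eq_of_mem_baseChange_W_of_mem_deltaSplit_sharp_F {p : ℤ} (hp : p + p = k) {x : ℂ ⊗[ℚ] V}
    (hreal : conj x = x) (hx : x ∈ (L.W k).baseChange ℂ)
    (hF : x ∈ (L.deltaSplit.toLimitMixedHodgeStructure.sharp L.isSplitOverR_deltaSplit).F p) :
    L.N.baseChange ℂ x = 0 ∧ L.deltaSplit.toLimitMixedHodgeStructure.nPlus x = 0 ∧
      L.deltaSplit.toLimitMixedHodgeStructure.deligneH x = 0 ∧ x ∈ L.deltaSplit.toMixedHodgeStructure.deligneI p p :=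
  L.deltaSplit.toLimitMixedHodgeStructure.sl2_invariant_of_conj_eq_of_mem_baseChange_W_of_mem_sharp_F L.isSplitOverR_deltaSplit hp
    hreal hx hF

end PolarizedLimitMixedHodgeStructure

end HodgeTheory

end Literature.AlgebraicGeometry

end
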